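import Literature.IUT.HodgeTheaters.TemperedCoveringsProTree
import Literature.AnabelianGeometry.SemiGraphs.TemperedAnabelian
import HarnessLib

/-!
# [IUTchI] Prop. 2.1 / 2.2: the profinite-completion side BY NAME (`IsProfiniteCompletion`)

Mochizuki, *Inter-universal Teichmüller theory I*, kurims manuscript (May 2020), §2 p. 44: "`Π̂_𝔾`
[is] the pro-`Σ̂` [i.e., maximal pro-`Σ̂` quotient of the profinite] fundamental group of `𝔾`" and
"we have a natural injection `Π^tp_𝔾 ↪ Π̂_𝔾` [cf., e.g., [SemiAnbd], Proposition 3.6, (iii), when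
`Σ̂ = 𝔓𝔯𝔦𝔪𝔢𝔰`]" [cite: Mochizuki2012, §2 p.44] (D-0012 claim key; nothing of the series is asserted).
PROOF-ONLY continuation of `TemperedCoveringsProTree.lean` (abc-iut-L5-t11): in the case
`Σ̂ = 𝔓𝔯𝔦𝔪𝔢𝔰`, where `Π̂_𝔾` is the profinite completion of `Π^tp_𝔾`, the completion-side hypotheses of
the Prop. 2.1 kernel are DISCHARGED BY NAME from abc-iut-L3-t2's predicate
`SemiGraphs.IsProfiniteCompletion` ([SemiAnbd] §6 p. 69, `TemperedAnabelian.lean`):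

* Hausdorffness of `Π̂_𝔾` ⇐ the field `IsProfiniteCompletion.t2Space`;
* (PC) "every open subgroup of finite index of `Π^tp_𝔾` is the trace of an open subgroup of `Π̂_𝔾`"
  (the first input of `closedBasis_of_residuallyFinite_quotients`) ⇐ the field
  `IsProfiniteCompletion.comap_surjective` (stated there for open NORMAL subgroups; the general case
  via the normal core, which is open of finite index) — `TemperedGraphGroupData.exists_isOpen_comap_eq_of_isProfiniteCompletion`;
* hence (RF) ⇐ `IsProfiniteCompletion` + "the countable discrete quotients `Gal(𝔾_{∞,i}/𝔾)` are
  residually finite for a cofinal family" (`hres`; [SemiAnbd] p. 38: they are virtually free — an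
  input no tree name states, kept as hypothesis) — `TemperedGraphGroupData.closedBasis_of_isProfiniteCompletion`.

Main declarations: `TemperedGraphGroupData.prop21_of_cosetTree_of_isProfiniteCompletion`,
`TemperedGraphGroupData.tp_isCommensurablyTerminal_of_cosetTree_of_isProfiniteCompletion` — Prop. 2.1
AS TYPED and Prop. 2.2 "in particular" with, on the completion side, only `hres` left, and on the
graph side (A1), (A3) and the node data as in `prop21_of_cosetTree` (for (A1) BY NAME from
[SemiAnbd] Thm 3.7 see `TemperedCoveringsCharts.lean`).  Not a discharge of the node IUTchI:Prop2.1;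
typed ≠ discharged; nothing here bears on [IUTchIII] Cor. 3.12.
-/

namespace Literature.IUT.HodgeTheaters

open Pointwise Filter
open _root_.Topology
open Literature.AnabelianGeometry.SemiGraphs (IsTempered IsProfiniteCompletion)
open Literature.AnabelianGeometry.AbsoluteAnabelian (IsCommensurablyTerminal)

universe u

namespace TemperedGraphGroupData

variable (D : TemperedGraphGroupData.{u})

/-- **(PC) BY NAME.**  If `Π̂_𝔾` is the profinite completion of `Π^tp_𝔾` (`IsProfiniteCompletion`,
[SemiAnbd] §6 p. 69 — the case `Σ̂ = 𝔓𝔯𝔦𝔪𝔢𝔰` of [IUTchI] §2 p. 44), then every open subgroup of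
finite index of `Π^tp_𝔾` is the inverse image of an open subgroup of `Π̂_𝔾`: apply
`IsProfiniteCompletion.comap_surjective` to the normal core (open, normal, of finite index) and
saturate. [cite: Mochizuki2012, §2 p.44] -/
theorem exists_isOpen_comap_eq_of_isProfiniteCompletion
    (h : IsProfiniteCompletion
      ({ toMonoidHom := D.ι, continuous_toFun := D.ι_continuous } : D.Tp →ₜ* D.Hat))
    (U : Subgroup D.Tp) (hUo : IsOpen (U : Set D.Tp)) (hU : U.FiniteIndex) :
    ∃ W : Subgroup D.Hat, IsOpen (W : Set D.Hat) ∧ W.comap D.ι = U := by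
  haveI : U.normalCore.FiniteIndex := Subgroup.finiteIndex_normalCore U
  have hCo : IsOpen (U.normalCore : Set D.Tp) :=
    Subgroup.isOpen_of_isClosed_of_finiteIndex _
      (Subgroup.normalCore_isClosed U (Subgroup.isClosed_of_isOpen U hUo))
  let C : OpenNormalSubgroup D.Tp :=
    { toSubgroup := U.normalCore, isOpen' := hCo, isNormal' := Subgroup.normalCore_normal U }
  obtain ⟨V, hV⟩ := h.comap_surjective C inferInstance
  have hVC : V.toSubgroup.comap D.ι = U.normalCore := hV.symm
  refine ⟨U.map D.ι ⊔ V.toSubgroup, Subgroup.isOpen_mono le_sup_right V.isOpen', ?_⟩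
  apply le_antisymm
  · intro x hx
    rw [Subgroup.mem_comap] at hx
    have hx' : D.ι x ∈ ((U.map D.ι ⊔ V.toSubgroup : Subgroup D.Hat) : Set D.Hat) := hx
    rw [Subgroup.mul_normal] at hx'
    obtain ⟨y, hy, v, hv, hyv⟩ := Set.mem_mul.mp hx'
    obtain ⟨u, hu, rfl⟩ := Subgroup.mem_map.mp hy
    -- `ι(u⁻¹ x) = v ∈ V`, so `u⁻¹ x ∈ ι⁻¹(V) = core U ≤ U`
    have huv : D.ι (u⁻¹ * x) ∈ V.toSubgroup := by
      rw [map_mul, map_inv, ← hyv, inv_mul_cancel_left]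
      exact hv
    have hux : u⁻¹ * x ∈ U := U.normalCore_le (hVC ▸ Subgroup.mem_comap.mpr huv)
    simpa using U.mul_mem hu hux
  · exact le_trans (Subgroup.le_comap_map D.ι U) (Subgroup.comap_mono le_sup_left)

/-- **(RF) for `Σ̂ = 𝔓𝔯𝔦𝔪𝔢𝔰`, completion side BY NAME**: if `Π̂_𝔾` is the profinite completion of
`Π^tp_𝔾` (`IsProfiniteCompletion`) and the countable discrete quotients `Π^tp_𝔾/N` are residually
finite for a cofinal family of open normal `N` ([SemiAnbd] p. 38: `Π^tp_𝔾 = lim Gal(𝔾_{∞,i}/𝔾)` with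
`Gal(𝔾_{∞,i}/𝔾)` virtually free), then the open normal subgroups of `Π^tp_𝔾` closed for the
`Π̂_𝔾`-topology are cofinal (abc-iut-L5-t11's `closedBasis_of_residuallyFinite_quotients`).
[cite: Mochizuki2012, Prop 2.1 p.45] -/
theorem closedBasis_of_isProfiniteCompletion
    (h : IsProfiniteCompletion
      ({ toMonoidHom := D.ι, continuous_toFun := D.ι_continuous } : D.Tp →ₜ* D.Hat))
    (hres : ∀ V ∈ 𝓝 (1 : D.Tp), ∃ N : OpenNormalSubgroup D.Tp, (N : Set D.Tp) ⊆ V ∧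
      Group.ResiduallyFinite (D.Tp ⧸ N.toSubgroup)) :
    ∀ V ∈ 𝓝 (1 : D.Tp), ∃ N : OpenNormalSubgroup D.Tp, (N : Set D.Tp) ⊆ V ∧
      ((N.toSubgroup.map D.ι).topologicalClosure).comap D.ι ≤ N.toSubgroup :=
  closedBasis_of_residuallyFinite_quotients D.ι
    (fun U hUo hU => D.exists_isOpen_comap_eq_of_isProfiniteCompletion h U hUo hU) hres

/-- **[IUTchI] Proposition 2.1 for `D` in the case `Σ̂ = 𝔓𝔯𝔦𝔪𝔢𝔰`, completion side BY NAME**: as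
`prop21_of_cosetTree_of_isTempered`, with Hausdorffness of `Π̂_𝔾` and (PC) supplied by
`IsProfiniteCompletion` ([SemiAnbd] §6 p. 69 / Prop 3.6 (iii)); remaining: temperedness of `Π^tp_𝔾`
(`hT`; BY NAME from a chart in `TemperedCoveringsCharts.lean`), `hres`, the verticial family and
node data, (A1), (A3). ([IUTchI] Prop 2.1 p.45) [claim: Mochizuki2012, status: disputed] -/
theorem prop21_of_cosetTree_of_isProfiniteCompletion (hT : IsTempered D.Tp)
    (h : IsProfiniteCompletion
      ({ toMonoidHom := D.ι, continuous_toFun := D.ι_continuous } : D.Tp →ₜ* D.Hat))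
    (hres : ∀ V ∈ 𝓝 (1 : D.Tp), ∃ N : OpenNormalSubgroup D.Tp, (N : Set D.Tp) ⊆ V ∧
      Group.ResiduallyFinite (D.Tp ⧸ N.toSubgroup))
    {V : Type*} (Λv : V → Subgroup D.Tp) {E : Type*} (src tgt : E → V) (c₁ c₂ : E → D.Tp)
    (hA1 : ∀ Λ : Subgroup D.Tp, IsCompact (Λ : Set D.Tp) → Λ ≠ ⊥ →
      ∃ (v : V) (t : D.Tp), Λ ≤ MulAut.conj t • Λv v)
    (hA3 : ∀ (v w : V) (g h : D.Hat),
      MulAut.conj g • (Λv v).map D.ι ⊓ MulAut.conj h • (Λv w).map D.ι ≠ ⊥ →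
        (v = w ∧ g⁻¹ * h ∈ (Λv v).map D.ι) ∨
        ∃ (e : E) (k : D.Hat), ∃ p ∈ (Λv (src e)).map D.ι, ∃ q ∈ (Λv (tgt e)).map D.ι,
          (src e = v ∧ tgt e = w ∧ g = k * D.ι (c₁ e) * p ∧ h = k * D.ι (c₂ e) * q) ∨
          (src e = w ∧ tgt e = v ∧ h = k * D.ι (c₁ e) * p ∧ g = k * D.ι (c₂ e) * q)) :
    D.ProfiniteConjugatesOfCompactSubgroups := by
  haveI : T2Space D.Hat := h.t2Space
  exact D.prop21_of_cosetTree_of_isTempered hT (D.closedBasis_of_isProfiniteCompletion h hres) Λv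
    src tgt c₁ c₂ hA1 hA3

/-- **[IUTchI] Proposition 2.2, "in particular, `Π^tp_𝔾` is commensurably terminal in `Π̂_𝔾`", for `D`
in the case `Σ̂ = 𝔓𝔯𝔦𝔪𝔢𝔰`, completion side BY NAME** (`IsProfiniteCompletion`); remaining hypotheses as in
`prop21_of_cosetTree_of_isProfiniteCompletion` plus one infinite compact `Λ_{v₀}`.
([IUTchI] Prop 2.2 p.45) [claim: Mochizuki2012, status: disputed] -/
theorem tp_isCommensurablyTerminal_of_cosetTree_of_isProfiniteCompletion (hT : IsTempered D.Tp)
    (h : IsProfiniteCompletion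
      ({ toMonoidHom := D.ι, continuous_toFun := D.ι_continuous } : D.Tp →ₜ* D.Hat))
    (hres : ∀ V ∈ 𝓝 (1 : D.Tp), ∃ N : OpenNormalSubgroup D.Tp, (N : Set D.Tp) ⊆ V ∧
      Group.ResiduallyFinite (D.Tp ⧸ N.toSubgroup))
    {V : Type*} (Λv : V → Subgroup D.Tp) {E : Type*} (src tgt : E → V) (c₁ c₂ : E → D.Tp)
    (hA1 : ∀ Λ : Subgroup D.Tp, IsCompact (Λ : Set D.Tp) → Λ ≠ ⊥ →
      ∃ (v : V) (t : D.Tp), Λ ≤ MulAut.conj t • Λv v)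
    (hA3 : ∀ (v w : V) (g h : D.Hat),
      MulAut.conj g • (Λv v).map D.ι ⊓ MulAut.conj h • (Λv w).map D.ι ≠ ⊥ →
        (v = w ∧ g⁻¹ * h ∈ (Λv v).map D.ι) ∨
        ∃ (e : E) (k : D.Hat), ∃ p ∈ (Λv (src e)).map D.ι, ∃ q ∈ (Λv (tgt e)).map D.ι,
          (src e = v ∧ tgt e = w ∧ g = k * D.ι (c₁ e) * p ∧ h = k * D.ι (c₂ e) * q) ∨
          (src e = w ∧ tgt e = v ∧ h = k * D.ι (c₁ e) * p ∧ g = k * D.ι (c₂ e) * q))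
    (v₀ : V) (hv₀c : IsCompact ((Λv v₀ : Subgroup D.Tp) : Set D.Tp))
    (hv₀inf : ((Λv v₀ : Subgroup D.Tp) : Set D.Tp).Infinite) :
    IsCommensurablyTerminal D.ι.range := by
  haveI : T2Space D.Hat := h.t2Space
  exact D.tp_isCommensurablyTerminal_of_cosetTree hT (D.closedBasis_of_isProfiniteCompletion h hres)
    Λv src tgt c₁ c₂ hA1 hA3 v₀ hv₀c hv₀inf

end TemperedGraphGroupData

end Literature.IUT.HodgeTheaters
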